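/-
Copyright (c) 2026 the pub-hodgecm-mathlib formalisation cell (harness21).  Prover seat hodgecm-mathlib-K2Liu-p13 (g3), Track B «K2-LIT»,
#184♮ = hLiu418 = `stmt-HodgeConjecture-24832`; ROAD Φ (RULING «M-156n»), consumer sheet fa2b1e3a29709f09 row G6-fin — TWO BY-VALUE LETTERS OF THE #41 TOP's
KIND-0 PACKAGE ★ `K2LiuSiegelEisensteinConstantTermPackage.exists_constantTerm_package` (K2E5-p17 (g8), ★ p861416) IN ITS OWN BYTES: `hfgr` (growth of the standard
family itself) DISCHARGED, and `(E₈, h8d, h8c, h8eq, h8g)` SUPPLIED from ★ `exists_bigCell_termPackage` (by value: scalar normalisation + continuation).  Asked by name: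
K2E5-p17 (g8) 2026-09-04T15:36:25Z «K2Liu-p13 (g3): … please post the instance's head».  THEOREMS ONLY (no `def`, no `instance`, no named-fact hypothesis, no `sorry`).
-/
import Summits.HodgeConjecture.HodgeConjecture.Theorems.K2LiuSiegelEisensteinBigCellTermPackage   -- ★ `exists_bigCell_termPackage`, growth machinery
import Summits.HodgeConjecture.HodgeConjecture.Theorems.K2LiuRankOneCentreContinuation          -- ★ `differentiable_siegelDeltaCharacter`
import HarnessLib

/-!
# Crux `HLiu418`, ROAD Φ, organ Φ8 (sheet row G6-fin): the KIND-0 letters `hfgr` and `E₈` of the #41 TOP's constant-term package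

Cell `hodgecm-mathlib`, crux item hLiu418 = `stmt-HodgeConjecture-24832` (helper lane, count-neutral).  GENERIC `n ≠ 0`, doubled frame `H(𝔸) = HA L e dV hdV dW hdW`.
★ `exists_constantTerm_package` (kind `S = 0` of the #41 TOP) takes BY VALUE, among others: `hfgr` — moderate growth of the standard family `f s h` in `adelicHeightGL (n+n)`
locally uniformly on `{0 < re s}` — and the big-cell package `(E₈, h8d, h8c, h8eq, h8g)` with
`h8eq : E₈ s h = (∏_{p∈P}(s−p)) · ((∫⁻ β ∂νN).toReal⁻¹ • M(s)f_s(h))` on `re s > n∕2`.  This file: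
* §1 **`standardFamily_growth`** — `hfgr` IS A THEOREM for a standard family with continuous members and unitary `χ` (★ `growth_of_equivariance_of_pointRepr` applied to
  `E := f` itself: `heqv` = the section property, `hω` = `‖character‖ = modDelta^{2re s+n}` vs height ★, `hrep` = ★ `exists_translate_repr` at `y = 1`, `hEd` = holomorphy of the
  family); stated in the TOP's bytes (`∃ C A r, 0 < r ∧ …`).
* §2 **`exists_E₈`** — the big-cell letters `(E₈, h8d, h8c, h8eq, h8g)` in the TOP's BYTES, from ★ `exists_bigCell_termPackage`: by value remain the scalar normalisation
  `(P, r, G, hG, hrG, a, hra)` and the continuation `(E, hEd, hEeq)` of `a(s)·M(s)f_s` (`νN` a Haar measure — the TOP's edition ≥ 2 uses `Measure.haar`; `β` enters only through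
  the real constant `(∫⁻ β ∂νN).toReal⁻¹`).
Sources: [Garrett2018, §3.10–§3.12]; [MoeglinWaldspurger1995, I.2.17, II.1.7, IV.1]; [HarrisKudlaSweet1996, (1.15)–(1.17), §6]; [KudlaSweet1997, §1]; [Tan1999, §1–§3].
HONEST LABEL.  Helper lemmas, count-neutral; `HC_CM` is proved only modulo the 7 printed citations (2 remaining named inputs:
hLiu418 = `stmt-HodgeConjecture-24832`, h413 = `stmt-HodgeConjecture-24833`) until rung 0 closes.
-/

set_option autoImplicit false
set_option linter.dupNamespace false -- the mandated namespace repeats `HodgeConjecture.HodgeConjecture`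

noncomputable section

open scoped Matrix NNReal ENNReal
open NumberField IsDedekindDomain MeasureTheory MeasureTheory.Measure Metric

namespace Summit.HodgeConjecture.HodgeConjecture.Cruxes.HLiu418.K2LiuSiegelEisensteinKindZeroBigCellLetters

open Literature.NumberTheory.GelbartRogawski1991.AdaptedBlocks
open Literature.NumberTheory.Automorphic Literature.NumberTheory.Automorphic.UnitaryGroup
open Literature.NumberTheory.GelbartRogawski1991 Literature.NumberTheory.GelbartRogawski1991.GRConstruction
open Literature.NumberTheory.K2Lit.SiegelDoubled Literature.NumberTheory.GaloisRepresentations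
open UnitaryDualPair
open Summit.HodgeConjecture.HodgeConjecture.Cruxes.HLiu418.K2LiuBigCellGrowthOfEquivariance
open Summit.HodgeConjecture.HodgeConjecture.Cruxes.HLiu418.K2LiuBigCellGrowthAssembled
open Summit.HodgeConjecture.HodgeConjecture.Cruxes.HLiu418.K2LiuBigCellGrowthOfStandard
open Summit.HodgeConjecture.HodgeConjecture.Cruxes.HLiu418.K2LiuModDeltaHeightComparison (exists_modDelta_rpow_le_height)
open Summit.HodgeConjecture.HodgeConjecture.Cruxes.HLiu418.K2LiuDoublingSectionIntegrableReduction (norm_siegelDeltaCharacter_rpow)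
open Summit.HodgeConjecture.HodgeConjecture.Cruxes.HLiu418.K2LiuRankOneCentreContinuation (differentiable_siegelDeltaCharacter)
open Summit.HodgeConjecture.HodgeConjecture.Cruxes.HLiu418.K2LiuSiegelEisensteinBigCellTermPackage (exists_bigCell_termPackage)

variable (L : Type) [Field L] [NumberField L] [IsCMField L]
variable {N M n : ℕ} (e : Fin N × Fin M ≃ Fin n)
  (dV : Fin N → L) (hdV : ∀ i, IsCMField.complexConj L (dV i) = dV i)
  (dW : Fin M → L) (hdW : ∀ i, IsCMField.complexConj L (dW i) = dW i)

/-! ## §1 `hfgr`: moderate growth of a standard family -/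

/-- `hω` for the section character itself: `‖χ_det(p)·modDelta(p)^{2s+n}‖ = modDelta(p)^{2 re s + n} ≤ C·adelicHeightGL(p)^A` locally uniformly in `s` (unitary `χ`;
★ `norm_siegelDeltaCharacter_rpow`, ★ `exists_modDelta_rpow_le_height`). [cite: MoeglinWaldspurger1995, II.1.7] [cite: Garrett2018, §3.10] -/
theorem hω_siegelDeltaCharacter [NeZero n] {χ : HeckeCharacter L} (hχ : χ.IsUnitary) :
    ∀ z : ℂ, 0 < z.re → ∃ C A ρ : ℝ, 0 ≤ C ∧ 0 ≤ A ∧ 0 < ρ ∧ ∀ s : ℂ, dist s z < ρ →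
      ∀ p ∈ {p : HA L e dV hdV dW hdW | IsSiegelDelta L e dV hdV dW hdW p},
        ‖siegelDeltaCharacter L e dV hdV dW hdW χ s p‖ ≤ C * adelicHeightGL (n + n) L (p : GL (Fin (n + n)) (AdeleRing (𝓞 L) L)) ^ A := by
  intro z _
  have hσ : ∀ x : ideleGroup L, ‖((χ x : ℂˣ) : ℂ)‖ = ideleNorm x ^ (0 : ℝ) := fun x => by rw [Real.rpow_zero]; exact hχ x
  obtain ⟨C, A, hC, hA, hle⟩ := exists_modDelta_rpow_le_height L e dV hdV dW hdW (2 * |z.re| + 2 + (n : ℝ)) (by positivity)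
  refine ⟨C, A, 1, hC, hA, one_pos, fun s hs p hp => ?_⟩
  rw [norm_siegelDeltaCharacter_rpow L e dV hdV dW hdW χ hσ s p, add_zero]
  refine hle p hp _ ?_
  have h1 : |s.re - z.re| ≤ 1 := by
    have h := Complex.abs_re_le_norm (s - z)
    rw [Complex.sub_re] at h
    exact h.trans (by rw [← Complex.dist_eq]; exact hs.le)
  have h2 : |s.re| ≤ |z.re| + 1 := by
    have := abs_sub_abs_le_abs_sub s.re z.re
    linarith
  calc |2 * s.re + (n : ℝ)| ≤ |2 * s.re| + |(n : ℝ)| := abs_add_le _ _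
    _ = 2 * |s.re| + (n : ℝ) := by rw [abs_mul, abs_of_pos (by norm_num : (0 : ℝ) < 2), Nat.abs_cast]
    _ ≤ 2 * |z.re| + 2 + (n : ℝ) := by linarith

/-- **`hfgr` — MODERATE GROWTH OF A STANDARD FAMILY** (unitary `χ`, continuous members), with the sign clauses: `‖f s h‖ ≤ C·adelicHeightGL(h)^A` locally uniformly on
`{0 < re s}`.  ★ `growth_of_equivariance_of_pointRepr` at `E := f`: `heqv` = section property, `hrep` = ★ `exists_translate_repr` ∕ `translate_repr_family` at `y = 1`,
`hEd` = holomorphy of the family, `hω` above. [cite: Garrett2018, §3.10] [cite: HarrisKudlaSweet1996, (1.17)] [cite: MoeglinWaldspurger1995, I.2.17] -/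
theorem standardFamily_growth' [NeZero n] (𝒦 : IwasawaDatum L e dV hdV dW hdW) {χ : HeckeCharacter L} (hχ : χ.IsUnitary)
    (f : ℂ → HA L e dV hdV dW hdW → ℂ) (hstd : IsStandardSectionFamily 𝒦 χ f) (hcont : ∀ s, Continuous (f s)) :
    ∀ z : ℂ, 0 < z.re → ∃ C A ρ : ℝ, 0 ≤ C ∧ 0 ≤ A ∧ 0 < ρ ∧ ∀ s : ℂ, dist s z < ρ → ∀ h : HA L e dV hdV dW hdW,
      ‖f s h‖ ≤ C * adelicHeightGL (n + n) L (h : GL (Fin (n + n)) (AdeleRing (𝓞 L) L)) ^ A := by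
  classical
  obtain ⟨CK, hCK, hPK⟩ := exists_hPK L e dV hdV dW hdW (n := n) 𝒦.isCompact_K
  obtain ⟨T, d, B, hB, hdB, hrep₀⟩ := exists_translate_repr L e dV hdV dW hdW 𝒦 (hstd.2.1 0) (hcont 0)
  have hrep : ∀ s : ℂ, (0 : ℝ) < s.re → ∀ k ∈ (𝒦.K : Set (HA L e dV hdV dW hdW)),
      f s k = ∑ i : ↥T, f s ((i : ↥𝒦.K) : HA L e dV hdV dW hdW) * d i k := by
    intro s _ k hk
    have h := translate_repr_family L e dV hdV dW hdW 𝒦 hstd.1.1 (fun k hk s s' => hstd.2.2 k hk s s') hrep₀ s 1 hk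
    simp only [one_mul] at h
    rw [h, ← Finset.sum_coe_sort]
    exact Finset.sum_congr rfl fun i _ => mul_comm _ _
  exact growth_of_equivariance_of_pointRepr (hIw_of_iwasawaDatum L e dV hdV dW hdW 𝒦)
    (fun x : HA L e dV hdV dW hdW => adelicHeightGL (n + n) L (x : GL (Fin (n + n)) (AdeleRing (𝓞 L) L))) (fun _ => adelicHeightGL_nonneg _)
    hCK hPK (fun p _ => (differentiable_siegelDeltaCharacter L e dV hdV dW hdW χ p).differentiableOn) (hω_siegelDeltaCharacter L e dV hdV dW hdW hχ)
    (fun h => (hstd.1.2 h).differentiableOn) le_rfl (fun s _ p hp x => hstd.1.1 s p hp x)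
    (kpt := fun i : ↥T => ((i : ↥𝒦.K) : HA L e dV hdV dW hdW)) hrep hB (fun i k hk => hdB i k hk)

/-- **`hfgr` IN THE TOP's BYTES** (★ `exists_constantTerm_package`): `∀ z, 0 < z.re → ∃ C A r, 0 < r ∧ ∀ s, dist s z < r → ∀ h, ‖f s h‖ ≤ C · adelicHeightGL (n+n) L ↑h ^ A`.
[cite: Garrett2018, §3.10] [cite: HarrisKudlaSweet1996, (1.17)] -/
theorem standardFamily_growth [NeZero n] (𝒦 : IwasawaDatum L e dV hdV dW hdW) {χ : HeckeCharacter L} (hχ : χ.IsUnitary)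
    (f : ℂ → HA L e dV hdV dW hdW → ℂ) (hstd : IsStandardSectionFamily 𝒦 χ f) (hcont : ∀ s, Continuous (f s)) :
    ∀ z : ℂ, 0 < z.re → ∃ C A r : ℝ, 0 < r ∧ ∀ s : ℂ, dist s z < r → ∀ h : HA L e dV hdV dW hdW,
      ‖f s h‖ ≤ C * adelicHeightGL (n + n) L (h : GL (Fin (n + n)) (AdeleRing (𝓞 L) L)) ^ A :=
  fun z hz => by
    obtain ⟨C, A, ρ, -, -, hρ, h⟩ := standardFamily_growth' L e dV hdV dW hdW 𝒦 hχ f hstd hcont z hz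
    exact ⟨C, A, ρ, hρ, h⟩

/-! ## §2 `E₈`: the big-cell letters of the kind-0 package, in the TOP's bytes -/

/-- **THE BIG-CELL LETTERS `(E₈, h8d, h8c, h8eq, h8g)` OF ★ `exists_constantTerm_package`, SUPPLIED.**  From ★ `exists_bigCell_termPackage` (`νN` Haar; any weight `β`, which
enters only through the real constant `c_β = (∫⁻ β ∂νN).toReal⁻¹`): `E₈ := c_β · Ec₈`.  By value remain the scalar normalisation `(P, r, G, a)` and the continuation
`(E, hEd, hEeq)` of `a(s)·M(s)f_s`. [cite: Garrett2018, §3.12] [cite: KudlaSweet1997, §1] [cite: Tan1999, §3] -/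
theorem exists_E₈ [NeZero n] (hdV0 : ∀ i, dV i ≠ 0) (hdW0 : ∀ i, dW i ≠ 0) (𝒦 : IwasawaDatum L e dV hdV dW hdW)
    [MeasurableSpace (unipDelta L e dV hdV dW hdW)] [BorelSpace (unipDelta L e dV hdV dW hdW)]
    (νN : Measure (unipDelta L e dV hdV dW hdW)) [νN.IsHaarMeasure] (β : unipDelta L e dV hdV dW hdW → ℝ≥0∞)
    (χ : HeckeCharacter L) (hχ : χ.IsUnitary)
    (f : ℂ → HA L e dV hdV dW hdW → ℂ) (hstd : IsStandardSectionFamily 𝒦 χ f) (hcont : ∀ s, Continuous (f s))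
    (P : Finset ℂ) (r G : ℂ → ℂ) (hG : DifferentiableOn ℂ G {s : ℂ | 0 < s.re})
    (hrG : ∀ s : ℂ, (n : ℝ) / 2 < s.re → (∏ p ∈ P, (s - p)) * r s = G s)
    (a : ℂ → ℂ) (hra : ∀ s : ℂ, (n : ℝ) / 2 < s.re → r s * a s = 1)
    (E : ℂ → HA L e dV hdV dW hdW → ℂ) (hEd : ∀ x : HA L e dV hdV dW hdW, DifferentiableOn ℂ (fun s : ℂ => E s x) {s : ℂ | 0 < s.re})
    (hEeq : ∀ (s : ℂ) (x : HA L e dV hdV dW hdW), (n : ℝ) / 2 < s.re → E s x = a s * intertwiningDelta L e dV hdV dW hdW νN (f s) x) :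
    ∃ E₈ : ℂ → HA L e dV hdV dW hdW → ℂ,
      (∀ h : HA L e dV hdV dW hdW, DifferentiableOn ℂ (fun s => E₈ s h) {s : ℂ | 0 < s.re}) ∧
      (∀ s : ℂ, 0 < s.re → Continuous (E₈ s)) ∧
      (∀ (s : ℂ) (h : HA L e dV hdV dW hdW), (n : ℝ) / 2 < s.re →
        E₈ s h = (∏ p ∈ P, (s - p)) * (((∫⁻ u, β u ∂νN).toReal⁻¹ : ℝ) • intertwiningDelta L e dV hdV dW hdW νN (f s) h)) ∧
      (∀ z : ℂ, 0 < z.re → ∃ C A r : ℝ, 0 < r ∧ ∀ s : ℂ, dist s z < r → ∀ h : HA L e dV hdV dW hdW,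
        ‖E₈ s h‖ ≤ C * adelicHeightGL (n + n) L (h : GL (Fin (n + n)) (AdeleRing (𝓞 L) L)) ^ A) := by
  obtain ⟨Ec₈, h1, h2, h4, h5⟩ := exists_bigCell_termPackage L e dV hdV dW hdW hdV0 hdW0 𝒦 νN χ hχ f hstd hcont P r G hG hrG a hra E hEd hEeq
  set c : ℝ := (∫⁻ u, β u ∂νN).toReal⁻¹ with hc
  refine ⟨fun s h => (c : ℂ) * Ec₈ s h, fun h => (h1 h).const_mul _, fun s hs => continuous_const.mul (h2 s hs), fun s h hs => ?_, fun z hz => ?_⟩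
  · show (c : ℂ) * Ec₈ s h = _
    rw [h4 s h hs, Complex.real_smul]
    ring
  · obtain ⟨C, A, ρ, hρ, hle⟩ := h5 z hz
    refine ⟨‖(c : ℂ)‖ * C, A, ρ, hρ, fun s hs h => ?_⟩
    rw [norm_mul, mul_assoc]
    exact mul_le_mul_of_nonneg_left (hle s hs h) (norm_nonneg _)

end Summit.HodgeConjecture.HodgeConjecture.Cruxes.HLiu418.K2LiuSiegelEisensteinKindZeroBigCellLetters

end
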